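import Literature.AlgebraicGeometry.Surfaces.K3LatticeOrthogonalNegTwoVectorOrbits
import Literature.Topology.FourManifolds.LatticeFormsNegTwoDVectorOrthogonalModel
import HarnessLib

/-!
# The lattices `{h, r}^⊥` and `{h, δ}^⊥` in `Λ_{K3}` for a `(−2d)`-vector `r` and a wall class `δ` (`δ² = −2`) of
# `Λ_d = h^⊥` (Gritsenko–Hulek–Sankaran, Invent. Math. 169 (2007) Prop. 4.6; Doc. Math. 13 (2008) Prop. 2.4 (ii))

Family `hodge`, layer `Literature/AlgebraicGeometry/Surfaces`. Sequel of `K3LatticeOrthogonalNegTwoVectorOrbits.lean`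
(the orbit COUNTS of `(−2)`- and `(−2d)`-vectors in `Λ_d`); this file names the LATTICES. `Λ_{K3}` is the tree's
`Matrix.toBilin' k3Gram` on `K3Index → ℤ` (even unimodular, rank `22`, signature `−16`:
`isEven/isUnimodular/signature_toBilin'_k3Gram`, `finrank_k3Index_fun`), `h = ℓ` a primitive vector with
`ℓ² = 2d > 0`, `Λ_d = ℓ^⊥ ≅ L_{2d}^{(2)} = (2E₈(−1) ⊕ 2U) ⊕ ⟨−2d⟩` (`k3Lattice_restrict_orthogonal_equivalent`,
Huybrechts Example 14.1.11 (i)). THEOREMS ONLY — no definition, no named fact.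

## Sources (verbatim)

* Gritsenko–Hulek–Sankaran, *The Kodaira dimension of the moduli of K3 surfaces*, Invent. Math. 169 (2007), §4
  (arXiv:math/0607339 numbering; held text p. 15), with `L_{2d} = h^⊥_{L_{K3}} = 2U ⊕ 2E₈(−1) ⊕ ⟨−2d⟩`:
  "**Proposition 4.6.** Let `r` be a primitive vector of `L_{2d}`" [with `r² = −2d`; "then `div(r) = d` or `2d`"].
  "If `div(r) = 2d` then `r^⊥_{L_{2d}} ≅ 2U ⊕ 2E₈(−1)`. If `div(r) = d` then either
  `r^⊥_{L_{2d}} ≅ U ⊕ 2E₈(−1) ⊕ ⟨2⟩ ⊕ ⟨−2⟩` or `r^⊥_{L_{2d}} ≅ U ⊕ 2E₈(−1) ⊕ U(2)`." Proof: "We put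
  `L_r = r^⊥_{L_{2d}}` and `S_r = (L_r)^⊥_{L_{K3}}` […] `S_r ≅ U(2)` if `δ_{S_r} = 0`, `⟨2⟩ ⊕ ⟨−2⟩` if `δ_{S_r} = 1`."
  The tree proves this for an abstract even unimodular `Λ` of rank `22` and signature `−16`
  (`LatticeFormsNegTwoDVectorOrthogonal`, §5); §1 below is its literal `L_{K3}` form.
* Gritsenko–Hulek–Sankaran, *Hirzebruch–Mumford proportionality and locally symmetric varieties of orthogonal type*,
  Doc. Math. 13 (2008), Prop. 2.4 (ii) (held text `paper:arxiv-math_0609774` p. 5), for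
  `L_{2d}^{(m)} = 2U ⊕ mE₈(−1) ⊕ ⟨−2d⟩`: "There is one `Õ^+(L_{2d}^{(m)})`-orbit of `(−2)`-vectors `r` in `L_{2d}^{(m)}`
  with `div(r) = 1`. If `d ≡ 1 mod 4` then there is a second orbit of `(−2)`-vectors, with `div(r) = 2`. The
  orthogonal complement of a `(−2)`-vector `r` in `L_{2d}^{(m)}` is isometric to
  `K_{2d}^{(m)} = U ⊕ mE₈(−1) ⊕ ⟨2⟩ ⊕ ⟨−2d⟩`, if `div(r) = 1`, and to `N_{2d}^{(m)} = U ⊕ mE₈(−1) ⊕ (1 2 ∕ (1−d)∕2 1)`,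
  if `div(r) = 2`." The tree proves this for the standalone model `L_{2d}^{(m)}`
  (`LatticeFormsNegTwoVectorOrbits`: `restrict_orthogonal_latticeL2dm_equivalent_of_apply_eq_one ∕ _of_forall_two_dvd`,
  with the symmetric Gram matrix `(2 1 ∕ 1 −2k)`, `d = 4k + 1`, of determinant `−d` for the rank-two block of
  `N_{2d}^{(m)}`, as printed in GHS, Doc. Math. 12 (2007) §4.6.2 — see the reading note there); §2 below reads it
  in `Λ_{K3}` for `m = 2`: the `(−2)`-vectors of `Λ_d` are the walls `Δ_h` of the period domain `Ω_{2d}`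
  ([GritsenkoHulekSankaran2013ModuliK3, §2.5]) and `{h, δ}^⊥` is the complement of the wall class `δ` in `Λ_d`.

## What is here (all proved)

* §0 `restrict_orthogonal_span_pair_equivalent_of_isometryEquiv_restrict_orthogonal`: for `δ ∈ ℓ^⊥` and
  `e : ℓ^⊥ ≅ L`, `{ℓ, δ}^⊥ ≅ (e δ)^⊥_L` (from `restrict_restrict_orthogonal_span_singleton_equivalent` and
  `restrict_orthogonal_equivalent_of_isometryEquiv`).
* §1 Prop. 4.6 for `L_{K3}`: `k3Lattice_restrict_orthogonal_span_pair_equivalent_of_two_mul_dvd`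
  (`div(r) = 2d ⟹ L_r ≅ 2U ⊕ 2E₈(−1)`), `…_or_of_not_two_mul_dvd` (`div(r) = d ⟹ L_r ≅ U ⊕ 2E₈(−1) ⊕ ⟨2⟩ ⊕ ⟨−2⟩`
  or `U ⊕ 2E₈(−1) ⊕ U(2)`), `…_of_deltaInvariant` (told by `δ(L_r)`).
* §2 walls: `k3Lattice_mem_orthogonal_span_singleton_iff`; `k3Lattice_exists_apply_eq_one_or_forall_two_dvd_of_neg_two`
  (`div(δ) ∈ {1, 2}` in `Λ_d`); `k3Lattice_mod_four_eq_one_of_neg_two_of_forall_two_dvd` (`div(δ) = 2 ⟹ d ≡ 1 (4)`);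
  **`k3Lattice_restrict_orthogonal_span_pair_equivalent_of_neg_two_of_apply_eq_one`** (`{h, δ}^⊥ ≅ K_{2d}^{(2)}`),
  **`…_of_neg_two_of_forall_two_dvd`** (`{h, δ}^⊥ ≅ N_{2d}^{(2)}`, `d = 4k + 1`), and the dichotomy
  `k3Lattice_restrict_orthogonal_span_pair_equivalent_or_of_neg_two`.

## Reading notes

* `div` is rendered by divisibility hypotheses inside `Λ_d = ℓ^⊥` (`∀ w, (w, ℓ) = 0 → n ∣ (r, w)`), as in the
  predecessors; primitivity of `r` in `Λ_{K3}` (`hrsat`) is primitivity in the saturated sublattice `Λ_d`.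
* `K_{2d}^{(2)}`, `N_{2d}^{(2)}` and the Prop. 4.6 lattices appear in the tree's normal forms
  `(((2E₈(−1) ⊕ U) ⊕ ⟨2⟩) ⊕ ⟨−2d⟩`, `(2E₈(−1) ⊕ U) ⊕ (2 1 ∕ 1 −2k)`, `2E₈(−1) ⊕ 2U`, `(2E₈(−1) ⊕ U) ⊕ (⟨2⟩ ⊕ ⟨−2⟩)`,
  `(2E₈(−1) ⊕ U) ⊕ U(2)`; all statements are up to isometry (`LinearMap.BilinForm.Equivalent`).

## References

* [GritsenkoHulekSankaran2007Kodaira] V. Gritsenko, K. Hulek, G. K. Sankaran, *The Kodaira dimension of the moduli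
  of K3 surfaces*, Invent. Math. 169 (2007) 519–567, arXiv:math/0607339 — §4 Prop. 4.6.
* [GritsenkoHulekSankaran2008Proportionality] V. Gritsenko, K. Hulek, G. K. Sankaran, *Hirzebruch–Mumford
  proportionality and locally symmetric varieties of orthogonal type*, Doc. Math. 13 (2008) 1–19 — Prop. 2.4 (ii).
* [GritsenkoHulekSankaran2007HM] V. Gritsenko, K. Hulek, G. K. Sankaran, *The Hirzebruch–Mumford volume for the
  orthogonal group and applications*, Doc. Math. 12 (2007) 215–241 — §4.6.1 (`K_{2d}^{(m)}`), §4.6.2 (`N_{2d}^{(m)}`).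
* [GritsenkoHulekSankaran2013ModuliK3] V. Gritsenko, K. Hulek, G. K. Sankaran, *Moduli of K3 surfaces and
  irreducible symplectic manifolds*, Handbook of Moduli I (2013), arXiv:1012.4155 — §2.5 (walls `Δ_h`).
* [Nikulin1980] V. V. Nikulin, *Integral symmetric bilinear forms and some of their applications*, Math. USSR Izv.
  14 (1980) 103–167 — Cor. 1.13.3, Thm. 3.6.2.
* [Huybrechts2016K3] D. Huybrechts, *Lectures on K3 surfaces*, CUP 2016 — Ch. 14 §0, Example 1.11 (i).
-/

noncomputable section

open Module Function
open LinearMap (BilinForm)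
open LinearMap.BilinForm

/-! ### §0 `{ℓ, δ}^⊥ ⊂ Λ` along an identification `e : ℓ^⊥ ≅ L` -/

namespace Literature.Topology.FourManifolds

variable {M : Type*} [AddCommGroup M] (B : BilinForm ℤ M) {N : Type*} [AddCommGroup N] {L : BilinForm ℤ N}

/-- For `δ ∈ ℓ^⊥` and an isometry `e : ℓ^⊥ ≅ L`, `{ℓ, δ}^⊥ ⊂ Λ` is isometric to `(e δ)^⊥ ⊂ L`.
[cite: GritsenkoHulekSankaran2007Kodaira, §4 (arXiv numbering) proof of Prop. 4.6 ("`L_r = r^⊥_{L_{2d}}`")] -/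
theorem restrict_orthogonal_span_pair_equivalent_of_isometryEquiv_restrict_orthogonal {ℓ : M}
    (e : (B.restrict (B.orthogonal (ℤ ∙ ℓ))).IsometryEquiv L) (δ : B.orthogonal (ℤ ∙ ℓ)) :
    (B.restrict (B.orthogonal (Submodule.span ℤ {ℓ, (δ : M)}))).Equivalent (L.restrict (L.orthogonal (ℤ ∙ e δ))) :=
  (restrict_restrict_orthogonal_span_singleton_equivalent B δ).symm.trans
    (restrict_orthogonal_equivalent_of_isometryEquiv e δ)

end Literature.Topology.FourManifolds

namespace Literature.AlgebraicGeometry.Surfaces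

open Literature.Topology.FourManifolds

/-! ### §1 GHS, Invent. Math. 169 (2007), Prop. 4.6 for `L_{K3}`: the lattice `L_r = {h, r}^⊥` of a `(−2d)`-vector -/

section NegTwoD

variable {ℓ r : K3Index → ℤ} {d : ℤ}

/-- **Prop. 4.6, `div(r) = 2d`, for `L_{K3}`**: `h ∈ L_{K3}` primitive with `h² = 2d > 0`, `r ∈ L_{2d} = h^⊥`
primitive with `r² = −2d` and `div(r) = 2d` (`2d ∣ (r, w)` for all `w ⊥ h`): `L_r = {h, r}^⊥ ≅ 2U ⊕ 2E₈(−1)`.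
[cite: GritsenkoHulekSankaran2007Kodaira, §4 (arXiv numbering) Prop. 4.6 ("If `div(r) = 2d` then `r^⊥_{L_{2d}} ≅ 2U ⊕ 2E₈(−1)`")] [cite: Nikulin1980, Cor. 1.13.3, Thm. 3.6.2] -/
theorem k3Lattice_restrict_orthogonal_span_pair_equivalent_of_two_mul_dvd (hd : 0 < d)
    (hℓ : Matrix.toBilin' k3Gram ℓ ℓ = 2 * d)
    (hℓsat : ∀ (k : ℤ) (w : K3Index → ℤ), k ≠ 0 → k • w ∈ ℤ ∙ ℓ → w ∈ ℤ ∙ ℓ)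
    (hrℓ : Matrix.toBilin' k3Gram r ℓ = 0) (hr : Matrix.toBilin' k3Gram r r = -(2 * d))
    (hrsat : ∀ (k : ℤ) (w : K3Index → ℤ), k ≠ 0 → k • w ∈ ℤ ∙ r → w ∈ ℤ ∙ r)
    (h2d : ∀ w, Matrix.toBilin' k3Gram w ℓ = 0 → 2 * d ∣ Matrix.toBilin' k3Gram r w) :
    ((Matrix.toBilin' k3Gram).restrict ((Matrix.toBilin' k3Gram).orthogonal (Submodule.span ℤ {ℓ, r}))).Equivalent
      ((LinearMap.BilinForm.pi fun _ : Fin 2 ↦ -e8Form).prod (hyperbolicSum 2)) :=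
  restrict_orthogonal_span_pair_equivalent_of_two_mul_dvd _ isSymm_toBilin'_k3Gram isEven_toBilin'_k3Gram
    isUnimodular_toBilin'_k3Gram finrank_k3Index_fun signature_toBilin'_k3Gram hd hℓ hℓsat hrℓ hr hrsat h2d

/-- **Prop. 4.6, `div(r) = d`, for `L_{K3}`**: with `h`, `r` as above but `d ∣ (r, L_{2d})`, `div(r) ≠ 2d`:
`L_r ≅ U ⊕ 2E₈(−1) ⊕ ⟨2⟩ ⊕ ⟨−2⟩` or `L_r ≅ U ⊕ 2E₈(−1) ⊕ U(2)`.
[cite: GritsenkoHulekSankaran2007Kodaira, §4 (arXiv numbering) Prop. 4.6 ("If `div(r) = d` then either `r^⊥_{L_{2d}} ≅ U ⊕ 2E₈(−1) ⊕ ⟨2⟩ ⊕ ⟨−2⟩` or `r^⊥_{L_{2d}} ≅ U ⊕ 2E₈(−1) ⊕ U(2)`")] [cite: Nikulin1980, Cor. 1.13.3, Thm. 3.6.2] -/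
theorem k3Lattice_restrict_orthogonal_span_pair_equivalent_or_of_not_two_mul_dvd (hd : 0 < d)
    (hℓ : Matrix.toBilin' k3Gram ℓ ℓ = 2 * d)
    (hℓsat : ∀ (k : ℤ) (w : K3Index → ℤ), k ≠ 0 → k • w ∈ ℤ ∙ ℓ → w ∈ ℤ ∙ ℓ)
    (hrℓ : Matrix.toBilin' k3Gram r ℓ = 0) (hr : Matrix.toBilin' k3Gram r r = -(2 * d))
    (hrsat : ∀ (k : ℤ) (w : K3Index → ℤ), k ≠ 0 → k • w ∈ ℤ ∙ r → w ∈ ℤ ∙ r)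
    (hdvd : ∀ w, Matrix.toBilin' k3Gram w ℓ = 0 → d ∣ Matrix.toBilin' k3Gram r w)
    (hndvd : ¬ ∀ w, Matrix.toBilin' k3Gram w ℓ = 0 → 2 * d ∣ Matrix.toBilin' k3Gram r w) :
    ((Matrix.toBilin' k3Gram).restrict ((Matrix.toBilin' k3Gram).orthogonal (Submodule.span ℤ {ℓ, r}))).Equivalent
        (((LinearMap.BilinForm.pi fun _ : Fin 2 ↦ -e8Form).prod (hyperbolicSum 1)).prod
          (BilinForm.prod ((2 : ℤ) • ((1 : ℤ) • LinearMap.mul ℤ ℤ)) ((2 : ℤ) • ((-1 : ℤ) • LinearMap.mul ℤ ℤ)))) ∨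
      ((Matrix.toBilin' k3Gram).restrict ((Matrix.toBilin' k3Gram).orthogonal (Submodule.span ℤ {ℓ, r}))).Equivalent
        (((LinearMap.BilinForm.pi fun _ : Fin 2 ↦ -e8Form).prod (hyperbolicSum 1)).prod ((2 : ℤ) • hyperbolicSum 1)) :=
  restrict_orthogonal_span_pair_equivalent_or_of_not_two_mul_dvd _ isSymm_toBilin'_k3Gram isEven_toBilin'_k3Gram
    isUnimodular_toBilin'_k3Gram finrank_k3Index_fun signature_toBilin'_k3Gram hd hℓ hℓsat hrℓ hr hrsat hdvd hndvd

/-- **Prop. 4.6, `div(r) = d`, the alternative told by `δ(L_r) = δ(S_r)`** for `L_{K3}`: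
`δ(L_r) = 1 ⟹ L_r ≅ U ⊕ 2E₈(−1) ⊕ ⟨2⟩ ⊕ ⟨−2⟩`, `δ(L_r) = 0 ⟹ L_r ≅ U ⊕ 2E₈(−1) ⊕ U(2)`.
[cite: GritsenkoHulekSankaran2007Kodaira, §4 (arXiv numbering) proof of Prop. 4.6 ("`S_r ≅ U(2)` if `δ_{S_r} = 0`, `⟨2⟩ ⊕ ⟨−2⟩` if `δ_{S_r} = 1`")] [cite: Nikulin1980, Cor. 1.13.3, Thm. 3.6.2] -/
theorem k3Lattice_restrict_orthogonal_span_pair_equivalent_of_deltaInvariant (hd : 0 < d)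
    (hℓ : Matrix.toBilin' k3Gram ℓ ℓ = 2 * d)
    (hℓsat : ∀ (k : ℤ) (w : K3Index → ℤ), k ≠ 0 → k • w ∈ ℤ ∙ ℓ → w ∈ ℤ ∙ ℓ)
    (hrℓ : Matrix.toBilin' k3Gram r ℓ = 0) (hr : Matrix.toBilin' k3Gram r r = -(2 * d))
    (hrsat : ∀ (k : ℤ) (w : K3Index → ℤ), k ≠ 0 → k • w ∈ ℤ ∙ r → w ∈ ℤ ∙ r)
    (hdvd : ∀ w, Matrix.toBilin' k3Gram w ℓ = 0 → d ∣ Matrix.toBilin' k3Gram r w)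
    (hndvd : ¬ ∀ w, Matrix.toBilin' k3Gram w ℓ = 0 → 2 * d ∣ Matrix.toBilin' k3Gram r w) :
    (∀ h₁ h₂ h₃, ((Matrix.toBilin' k3Gram).restrict
        ((Matrix.toBilin' k3Gram).orthogonal (Submodule.span ℤ {ℓ, r}))).deltaInvariant h₁ h₂ h₃ = 1 →
      ((Matrix.toBilin' k3Gram).restrict ((Matrix.toBilin' k3Gram).orthogonal (Submodule.span ℤ {ℓ, r}))).Equivalent
        (((LinearMap.BilinForm.pi fun _ : Fin 2 ↦ -e8Form).prod (hyperbolicSum 1)).prod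
          (BilinForm.prod ((2 : ℤ) • ((1 : ℤ) • LinearMap.mul ℤ ℤ)) ((2 : ℤ) • ((-1 : ℤ) • LinearMap.mul ℤ ℤ))))) ∧
    (∀ h₁ h₂ h₃, ((Matrix.toBilin' k3Gram).restrict
        ((Matrix.toBilin' k3Gram).orthogonal (Submodule.span ℤ {ℓ, r}))).deltaInvariant h₁ h₂ h₃ = 0 →
      ((Matrix.toBilin' k3Gram).restrict ((Matrix.toBilin' k3Gram).orthogonal (Submodule.span ℤ {ℓ, r}))).Equivalent
        (((LinearMap.BilinForm.pi fun _ : Fin 2 ↦ -e8Form).prod (hyperbolicSum 1)).prod ((2 : ℤ) • hyperbolicSum 1))) :=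
  restrict_orthogonal_span_pair_equivalent_of_deltaInvariant _ isSymm_toBilin'_k3Gram isEven_toBilin'_k3Gram
    isUnimodular_toBilin'_k3Gram finrank_k3Index_fun signature_toBilin'_k3Gram hd hℓ hℓsat hrℓ hr hrsat hdvd hndvd

end NegTwoD

/-! ### §2 GHS, Doc. Math. 13 (2008), Prop. 2.4 (ii) read in `Λ_{K3}`: the lattice `{h, δ}^⊥` of a wall class `δ` -/

section Walls

variable {ℓ : K3Index → ℤ} {d : ℕ}

/-- `w ∈ h^⊥ ⟺ (w, h) = 0` for the (symmetric) K3 form. [cite: Huybrechts2016K3, Ch. 14 §0.1] -/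
theorem k3Lattice_mem_orthogonal_span_singleton_iff {w : K3Index → ℤ} :
    w ∈ (Matrix.toBilin' k3Gram).orthogonal (ℤ ∙ ℓ) ↔ Matrix.toBilin' k3Gram w ℓ = 0 := by
  rw [(Matrix.toBilin' k3Gram).mem_orthogonal_span_singleton_iff, isSymm_toBilin'_k3Gram.eq]

/-- **A wall class has divisor `1` or `2` in `Λ_d`**: for `δ ∈ Λ_d = h^⊥` with `δ² = −2`, either `(δ, δ') = 1` for
some `δ' ∈ Λ_d`, or `(δ, Λ_d) ⊂ 2ℤ`. [cite: GritsenkoHulekSankaran2008Proportionality, Prop. 2.4 (ii) and proof ("the `(−2)`-vectors form two possible orbits of vectors with divisor equal to `1` or `2`")] -/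
theorem k3Lattice_exists_apply_eq_one_or_forall_two_dvd_of_neg_two {δ : K3Index → ℤ}
    (hδℓ : Matrix.toBilin' k3Gram δ ℓ = 0) (hδ : Matrix.toBilin' k3Gram δ δ = -2) :
    (∃ δ', Matrix.toBilin' k3Gram δ' ℓ = 0 ∧ Matrix.toBilin' k3Gram δ δ' = 1) ∨
      ∀ w, Matrix.toBilin' k3Gram w ℓ = 0 → (2 : ℤ) ∣ Matrix.toBilin' k3Gram δ w := by
  have h := exists_apply_eq_one_or_forall_two_dvd_of_apply_self_eq_neg_two
    ((Matrix.toBilin' k3Gram).restrict ((Matrix.toBilin' k3Gram).orthogonal (ℤ ∙ ℓ)))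
    (r := ⟨δ, k3Lattice_mem_orthogonal_span_singleton_iff.2 hδℓ⟩) hδ
  exact h.imp (fun ⟨δ', h'⟩ ↦ ⟨δ', k3Lattice_mem_orthogonal_span_singleton_iff.1 δ'.2, h'⟩)
    fun h' w hw ↦ h' ⟨w, k3Lattice_mem_orthogonal_span_singleton_iff.2 hw⟩

/-- **The second kind of wall forces `d ≡ 1 (mod 4)`**: if `δ ∈ Λ_d`, `δ² = −2` and `(δ, Λ_d) ⊂ 2ℤ`, then
`d ≡ 1 mod 4`. [cite: GritsenkoHulekSankaran2008Proportionality, Prop. 2.4 (ii) and proof ("if `r² = −2` and `div(r) = 2` then […] `d ≡ 1 mod 4`")] -/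
theorem k3Lattice_mod_four_eq_one_of_neg_two_of_forall_two_dvd (hd : 0 < d)
    (hℓ : Matrix.toBilin' k3Gram ℓ ℓ = 2 * d)
    (hℓsat : ∀ (k : ℤ) (w : K3Index → ℤ), k ≠ 0 → k • w ∈ ℤ ∙ ℓ → w ∈ ℤ ∙ ℓ) {δ : K3Index → ℤ}
    (hδℓ : Matrix.toBilin' k3Gram δ ℓ = 0) (hδ : Matrix.toBilin' k3Gram δ δ = -2)
    (h2 : ∀ w, Matrix.toBilin' k3Gram w ℓ = 0 → (2 : ℤ) ∣ Matrix.toBilin' k3Gram δ w) : d % 4 = 1 :=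
  (k3Lattice_exists_neg_two_forall_two_dvd_iff hd hℓ hℓsat).1
    ⟨⟨δ, k3Lattice_mem_orthogonal_span_singleton_iff.2 hδℓ⟩, hδ,
      fun z ↦ h2 z (k3Lattice_mem_orthogonal_span_singleton_iff.1 z.2)⟩

/-- **`{h, δ}^⊥ ≅ K_{2d}^{(2)} = U ⊕ 2E₈(−1) ⊕ ⟨2⟩ ⊕ ⟨−2d⟩` for a wall class of divisor `1`**: `h ∈ Λ_{K3}` primitive
with `h² = 2d > 0`, `δ, δ' ∈ Λ_d = h^⊥` with `δ² = −2`, `(δ, δ') = 1`; then the orthogonal complement of `ℤh + ℤδ`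
in `Λ_{K3}` — the complement of `δ` in `Λ_d ≅ L_{2d}^{(2)} = 2U ⊕ 2E₈(−1) ⊕ ⟨−2d⟩` — is
`≅ ((2E₈(−1) ⊕ U) ⊕ ⟨2⟩) ⊕ ⟨−2d⟩`. [cite: GritsenkoHulekSankaran2008Proportionality, Prop. 2.4 (ii) ("The orthogonal complement of a `(−2)`-vector `r` in `L_{2d}^{(m)}` is isometric to `K_{2d}^{(m)} = U ⊕ mE₈(−1) ⊕ ⟨2⟩ ⊕ ⟨−2d⟩, if `div(r) = 1`")] [cite: Huybrechts2016K3, Ch. 14 Example 1.11 (i)] -/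
theorem k3Lattice_restrict_orthogonal_span_pair_equivalent_of_neg_two_of_apply_eq_one (hd : 0 < d)
    (hℓ : Matrix.toBilin' k3Gram ℓ ℓ = 2 * d)
    (hℓsat : ∀ (k : ℤ) (w : K3Index → ℤ), k ≠ 0 → k • w ∈ ℤ ∙ ℓ → w ∈ ℤ ∙ ℓ) {δ δ' : K3Index → ℤ}
    (hδℓ : Matrix.toBilin' k3Gram δ ℓ = 0) (hδ : Matrix.toBilin' k3Gram δ δ = -2)
    (hδ'ℓ : Matrix.toBilin' k3Gram δ' ℓ = 0) (hδδ' : Matrix.toBilin' k3Gram δ δ' = 1) :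
    ((Matrix.toBilin' k3Gram).restrict ((Matrix.toBilin' k3Gram).orthogonal (Submodule.span ℤ {ℓ, δ}))).Equivalent
      ((((LinearMap.BilinForm.pi fun _ : Fin 2 ↦ -e8Form).prod (hyperbolicSum 1)).prod
        ((2 : ℤ) • LinearMap.mul ℤ ℤ)).prod ((-(2 * d : ℤ)) • LinearMap.mul ℤ ℤ)) := by
  have hℓ0 : ℓ ≠ 0 := by
    rintro rfl
    simp only [map_zero] at hℓ
    omega
  obtain ⟨e⟩ := k3Lattice_restrict_orthogonal_equivalent (d := (d : ℤ)) hℓ hℓ0 hℓsat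
  have hr : (((LinearMap.BilinForm.pi fun _ : Fin 2 ↦ -e8Form).prod (hyperbolicSum 2)).prod
      ((-(2 * d : ℤ)) • LinearMap.mul ℤ ℤ)) (e ⟨δ, k3Lattice_mem_orthogonal_span_singleton_iff.2 hδℓ⟩)
      (e ⟨δ, k3Lattice_mem_orthogonal_span_singleton_iff.2 hδℓ⟩) = -2 := by
    rw [e.map_app]
    simp only [LinearMap.BilinForm.restrict_apply, LinearMap.domRestrict_apply]
    exact hδ
  have hr' : (((LinearMap.BilinForm.pi fun _ : Fin 2 ↦ -e8Form).prod (hyperbolicSum 2)).prod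
      ((-(2 * d : ℤ)) • LinearMap.mul ℤ ℤ)) (e ⟨δ, k3Lattice_mem_orthogonal_span_singleton_iff.2 hδℓ⟩)
      (e ⟨δ', k3Lattice_mem_orthogonal_span_singleton_iff.2 hδ'ℓ⟩) = 1 := by
    rw [e.map_app]
    simp only [LinearMap.BilinForm.restrict_apply, LinearMap.domRestrict_apply]
    exact hδδ'
  exact (restrict_orthogonal_span_pair_equivalent_of_isometryEquiv_restrict_orthogonal (Matrix.toBilin' k3Gram) e
    ⟨δ, k3Lattice_mem_orthogonal_span_singleton_iff.2 hδℓ⟩).trans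
    (restrict_orthogonal_latticeL2dm_equivalent_of_apply_eq_one 2 d hd hr hr')

/-- **`{h, δ}^⊥ ≅ N_{2d}^{(2)} = (2E₈(−1) ⊕ U) ⊕ (2 1 ∕ 1 −2k)` for a wall class of divisor `2`** (`d = 4k + 1`):
`h ∈ Λ_{K3}` primitive with `h² = 2d > 0`, `δ ∈ Λ_d` with `δ² = −2` and `(δ, Λ_d) ⊂ 2ℤ`; then the orthogonal
complement of `ℤh + ℤδ` in `Λ_{K3}` is `≅ (2E₈(−1) ⊕ U) ⊕ (2 1 ∕ 1 −2k)` (the symmetric Gram matrix of determinant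
`−d` of GHS's rank-two block of `N_{2d}^{(m)}`, as in `LatticeFormsNegTwoVectorOrbits`).
[cite: GritsenkoHulekSankaran2008Proportionality, Prop. 2.4 (ii) ("and to `N_{2d}^{(m)} = U ⊕ mE₈(−1) ⊕ (1 2 ∕ (1−d)∕2 1)`, if `div(r) = 2`")] [cite: GritsenkoHulekSankaran2007HM, §4.6.2] [cite: Huybrechts2016K3, Ch. 14 Example 1.11 (i)] -/
theorem k3Lattice_restrict_orthogonal_span_pair_equivalent_of_neg_two_of_forall_two_dvd (hd : 0 < d) {k : ℤ}
    (hk : (d : ℤ) = 4 * k + 1) (hℓ : Matrix.toBilin' k3Gram ℓ ℓ = 2 * d)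
    (hℓsat : ∀ (k : ℤ) (w : K3Index → ℤ), k ≠ 0 → k • w ∈ ℤ ∙ ℓ → w ∈ ℤ ∙ ℓ) {δ : K3Index → ℤ}
    (hδℓ : Matrix.toBilin' k3Gram δ ℓ = 0) (hδ : Matrix.toBilin' k3Gram δ δ = -2)
    (h2 : ∀ w, Matrix.toBilin' k3Gram w ℓ = 0 → (2 : ℤ) ∣ Matrix.toBilin' k3Gram δ w) :
    ((Matrix.toBilin' k3Gram).restrict ((Matrix.toBilin' k3Gram).orthogonal (Submodule.span ℤ {ℓ, δ}))).Equivalent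
      (((LinearMap.BilinForm.pi fun _ : Fin 2 ↦ -e8Form).prod (hyperbolicSum 1)).prod
        (Matrix.toBilin' !![2, 1; 1, -(2 * k)])) := by
  have hℓ0 : ℓ ≠ 0 := by
    rintro rfl
    simp only [map_zero] at hℓ
    omega
  obtain ⟨e⟩ := k3Lattice_restrict_orthogonal_equivalent (d := (d : ℤ)) hℓ hℓ0 hℓsat
  have hr : (((LinearMap.BilinForm.pi fun _ : Fin 2 ↦ -e8Form).prod (hyperbolicSum 2)).prod
      ((-(2 * d : ℤ)) • LinearMap.mul ℤ ℤ)) (e ⟨δ, k3Lattice_mem_orthogonal_span_singleton_iff.2 hδℓ⟩)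
      (e ⟨δ, k3Lattice_mem_orthogonal_span_singleton_iff.2 hδℓ⟩) = -2 := by
    rw [e.map_app]
    simp only [LinearMap.BilinForm.restrict_apply, LinearMap.domRestrict_apply]
    exact hδ
  have h2' := (forall_dvd_apply_iff_of_isometryEquiv e ⟨δ, k3Lattice_mem_orthogonal_span_singleton_iff.2 hδℓ⟩ 2).2
    fun z ↦ by
      simpa only [LinearMap.BilinForm.restrict_apply, LinearMap.domRestrict_apply] using
        h2 z (k3Lattice_mem_orthogonal_span_singleton_iff.1 z.2)
  exact (restrict_orthogonal_span_pair_equivalent_of_isometryEquiv_restrict_orthogonal (Matrix.toBilin' k3Gram) e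
    ⟨δ, k3Lattice_mem_orthogonal_span_singleton_iff.2 hδℓ⟩).trans
    (restrict_orthogonal_latticeL2dm_equivalent_of_forall_two_dvd 2 d hd hk hr h2')

/-- **GHS Prop. 2.4 (ii), the complement of a wall class, for `Λ_d ⊂ Λ_{K3}`**: `h ∈ Λ_{K3}` primitive with
`h² = 2d > 0`, `δ ∈ Λ_d = h^⊥` with `δ² = −2`; then `{h, δ}^⊥ ≅ K_{2d}^{(2)} = ((2E₈(−1) ⊕ U) ⊕ ⟨2⟩) ⊕ ⟨−2d⟩`
(`div(δ) = 1`), or `d = 4k + 1` and `{h, δ}^⊥ ≅ N_{2d}^{(2)} = (2E₈(−1) ⊕ U) ⊕ (2 1 ∕ 1 −2k)` (`div(δ) = 2`).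
[cite: GritsenkoHulekSankaran2008Proportionality, Prop. 2.4 (ii)] [cite: GritsenkoHulekSankaran2007HM, §4.6.1–§4.6.2] [cite: Huybrechts2016K3, Ch. 14 Example 1.11 (i)] -/
theorem k3Lattice_restrict_orthogonal_span_pair_equivalent_or_of_neg_two (hd : 0 < d)
    (hℓ : Matrix.toBilin' k3Gram ℓ ℓ = 2 * d)
    (hℓsat : ∀ (k : ℤ) (w : K3Index → ℤ), k ≠ 0 → k • w ∈ ℤ ∙ ℓ → w ∈ ℤ ∙ ℓ) {δ : K3Index → ℤ}
    (hδℓ : Matrix.toBilin' k3Gram δ ℓ = 0) (hδ : Matrix.toBilin' k3Gram δ δ = -2) :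
    ((Matrix.toBilin' k3Gram).restrict ((Matrix.toBilin' k3Gram).orthogonal (Submodule.span ℤ {ℓ, δ}))).Equivalent
        ((((LinearMap.BilinForm.pi fun _ : Fin 2 ↦ -e8Form).prod (hyperbolicSum 1)).prod
          ((2 : ℤ) • LinearMap.mul ℤ ℤ)).prod ((-(2 * d : ℤ)) • LinearMap.mul ℤ ℤ)) ∨
      ∃ k : ℤ, (d : ℤ) = 4 * k + 1 ∧
        ((Matrix.toBilin' k3Gram).restrict
            ((Matrix.toBilin' k3Gram).orthogonal (Submodule.span ℤ {ℓ, δ}))).Equivalent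
          (((LinearMap.BilinForm.pi fun _ : Fin 2 ↦ -e8Form).prod (hyperbolicSum 1)).prod
            (Matrix.toBilin' !![2, 1; 1, -(2 * k)])) := by
  rcases k3Lattice_exists_apply_eq_one_or_forall_two_dvd_of_neg_two hδℓ hδ with ⟨δ', hδ'ℓ, hδδ'⟩ | h2
  · exact Or.inl (k3Lattice_restrict_orthogonal_span_pair_equivalent_of_neg_two_of_apply_eq_one hd hℓ hℓsat hδℓ hδ
      hδ'ℓ hδδ')
  · have h4 := k3Lattice_mod_four_eq_one_of_neg_two_of_forall_two_dvd hd hℓ hℓsat hδℓ hδ h2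
    have hk : (d : ℤ) = 4 * (d / 4 : ℕ) + 1 := by omega
    exact Or.inr ⟨_, hk, k3Lattice_restrict_orthogonal_span_pair_equivalent_of_neg_two_of_forall_two_dvd hd hk hℓ
      hℓsat hδℓ hδ h2⟩

end Walls

end Literature.AlgebraicGeometry.Surfaces

end
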